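import Mathlib
import HarnessLib
import Summits.HubbardSuperconductivity.HubbardSuperconductivity.Theorems.KLProgrammeKLRegimeTwoVolumeModelScaleSucc
import Summits.HubbardSuperconductivity.HubbardSuperconductivity.Theorems.KLProgrammeKLRegimeTwoVolumeStepEpsHomog
import Summits.HubbardSuperconductivity.HubbardSuperconductivity.Theorems.KLProgrammeKLRegimeTwoVolumeFrameCompositeLinear

/-!
# Route `KLProgramme` — crux K3, VL child `KLRegimeVolumeLimitV17F2` (stmt-HubbardSuperconductivity-20440), blueprint v5 M5: THE MODEL STEP IN THE SPINE'S
# CURRENCY — normalised data in, `ε ×` a volume-free linear form out (seat hubbard-kl-k3c4-p1 g12; `--supports` 20440)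

`…TwoVolumeModelScaleSucc.model_sum_norm_kernel_twoVolume_scaleSucc_composite_le` (p596126) read in the normalisation of record (every block of the doubled
analysis carries `ε = imagTimeWeight β M`: covariance rows `aW/ε`, profiles `ε·N`, deep/everywhere two-volume data `ε·Ej, ε·NDj`, frame rows `cR/ε, cC/ε`;
entry sups, sectional rows, Gram constants, transfer masses, `sE`, `δ` ε-free) and with every field-weighted norm of a budget replaced by a VOLUME-FREE majorant
`ν…` under barred smallness conditions: the keyed deep defect one scale up is at most
`ε · (KE·‖Ein‖ + KD·(1+Λ(R′+1))⁻¹ + KTeF·(eW′/(1+Λ(R+1)) + (sE + (cR+cC) + δ)) + KT·aW′/(1+Λ(R+1)) + KRf·(Λ(R′+1))⁻¹)` with the volume-free coefficients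
of `…StepLinear` / `…FrameCompositeLinear` (the frame composite folded into the `Te` slot) — the `hrec` line of `…DefectSupSpine.defectSup_eventually_le_of_bdd`
at one instance.  Tools: `…StepEpsHomog`, `…FrameCompositeLinear`, `…StepLinear`, `…NormVKit`.

* **`model_twoVolume_scaleSucc_le_eps_mul_linear`**.

Proofs only; no definition.
-/

noncomputable section

namespace Summit.HubbardSuperconductivity.HubbardSuperconductivity.Theorems.TwoVolumeDefect

set_option linter.dupNamespace false -- summit = problem name (single-conjunct summit), D-0017

open Finset Literature.MathematicalPhysics.QuantumLattice GrassmannAlgebra Literature.Probability.LatticeModels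
  Literature.Probability.LatticeModels.BattleFederbush
open Summit.HubbardSuperconductivity.HubbardSuperconductivity.Theorems.TwoPointAssembly
open Summit.HubbardSuperconductivity.HubbardSuperconductivity.Theorems.KLRegimeSplit
open Summit.HubbardSuperconductivity.HubbardSuperconductivity.Theorems.KLProgrammeLegKernels
open Summit.HubbardSuperconductivity.HubbardSuperconductivity.Theorems.EngineV8

set_option maxHeartbeats 800000 in -- one ~150-binder instantiation plus the normalisation algebra
/-- **THE MODEL STEP IN THE SPINE'S CURRENCY** (see the module docstring). [folklore: bookkeeping; cite: BenfattoGiulianiMastropietro2006, §2.7-§2.9 and §3] -/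
theorem model_twoVolume_scaleSucc_le_eps_mul_linear {b L Lf M N₁ : ℕ} [NeZero Lf] [NeZero L] [NeZero M] (μ : ℝ) (K : TrigPolyC4v) (j : ℕ)
    [LinearOrder ((SpaceTimeIdx Lf M × SectorLeg (sectorCount j)) × Fin 2)]
    (hLf : Lf = b * L) {β : ℝ} (hβ : β ≠ 0) {Λ : ℝ} (hΛ : 0 < Λ)
    -- the block structures of the scale-`j+1` and scale-`j` legs and their doublings
    (e : (SpaceTimeIdx Lf M × SectorLeg (sectorCount j)) ≃ (Fin 2 → Fin b) × (SpaceTimeIdx L M × SectorLeg (sectorCount j)))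
    (he1 : ∀ X' i, ((e X').1 i : ℕ) = (X'.1.2 i).val / L) (he2 : ∀ X', (e X').2 = ((X'.1.1, fun i => (((X'.1.2 i).val : ℕ) : ZMod L)), X'.2))
    (ed : ((SpaceTimeIdx Lf M × SectorLeg (sectorCount j)) × Fin 2) ≃ (Fin 2 → Fin b) × ((SpaceTimeIdx L M × SectorLeg (sectorCount j)) × Fin 2)) (hed : ∀ x s, ed (x, s) = ((e x).1, ((e x).2, s)))
    (e₁ : (SpaceTimeIdx Lf M × SectorLeg N₁) ≃ (Fin 2 → Fin b) × (SpaceTimeIdx L M × SectorLeg N₁))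
    (he₁1 : ∀ X' i, ((e₁ X').1 i : ℕ) = (X'.1.2 i).val / L) (he₁2 : ∀ X', (e₁ X').2 = ((X'.1.1, fun i => (((X'.1.2 i).val : ℕ) : ZMod L)), X'.2))
    (ed₁ : ((SpaceTimeIdx Lf M × SectorLeg N₁) × Fin 2) ≃ (Fin 2 → Fin b) × ((SpaceTimeIdx L M × SectorLeg N₁) × Fin 2)) (hed₁ : ∀ x s, ed₁ (x, s) = ((e₁ x).1, ((e₁ x).2, s)))
    -- THE MODEL'S STEP COVARIANCES at frame `K` on both lattices: `S(F̃_j[K])ᵀ · C^K_{(Λ_{j+2},Λ_{j+1}]} · S(F̃_j[K])`, and their spectator lifts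
    (CL : Matrix (SpaceTimeIdx L M × SectorLeg (sectorCount j)) (SpaceTimeIdx L M × SectorLeg (sectorCount j)) ℂ)
    (hCL : CL = (sectorSubMatrix L M β (bgmFatMultiplier L M klE0 β (nambuXiCT L μ K) j)).transpose *
      hubbardCovSliceCT L M β μ 0 K (klScale klE0 (j + 2)) (klScale klE0 (j + 1)) * sectorSubMatrix L M β (bgmFatMultiplier L M klE0 β (nambuXiCT L μ K) j))
    (CLf : Matrix (SpaceTimeIdx Lf M × SectorLeg (sectorCount j)) (SpaceTimeIdx Lf M × SectorLeg (sectorCount j)) ℂ)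
    (hCLf : CLf = (sectorSubMatrix Lf M β (bgmFatMultiplier Lf M klE0 β (nambuXiCT Lf μ K) j)).transpose *
      hubbardCovSliceCT Lf M β μ 0 K (klScale klE0 (j + 2)) (klScale klE0 (j + 1)) * sectorSubMatrix Lf M β (bgmFatMultiplier Lf M klE0 β (nambuXiCT Lf μ K) j))
    (Cd : Matrix ((SpaceTimeIdx L M × SectorLeg (sectorCount j)) × Fin 2) ((SpaceTimeIdx L M × SectorLeg (sectorCount j)) × Fin 2) ℂ) (hCd : ∀ p q, Cd p q = if p.2 = 0 ∧ q.2 = 0 then CL p.1 q.1 else 0)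
    (Cd' : Matrix ((SpaceTimeIdx Lf M × SectorLeg (sectorCount j)) × Fin 2) ((SpaceTimeIdx Lf M × SectorLeg (sectorCount j)) × Fin 2) ℂ) (hCd' : ∀ p q, Cd' p q = if p.2 = 0 ∧ q.2 = 0 then CLf p.1 q.1 else 0)
    -- the re-analysis blocks `T_V` related by periodisation, the source relabellings `J_V`, the block substitutions `T⁺_V`
    (Tc : Matrix (SpaceTimeIdx L M × SectorLeg (sectorCount j)) (SpaceTimeIdx L M × SectorLeg N₁) ℂ)
    (Tf : Matrix (SpaceTimeIdx Lf M × SectorLeg (sectorCount j)) (SpaceTimeIdx Lf M × SectorLeg N₁) ℂ)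
    (hPT₀ : ∀ (X' : (SpaceTimeIdx Lf M × SectorLeg (sectorCount j))) (Y : (SpaceTimeIdx L M × SectorLeg N₁)),
      ∑ Y'' ∈ univ.filter (fun Y'' : (SpaceTimeIdx Lf M × SectorLeg N₁) => (e₁ Y'').2 = Y), Tf X' Y'' = Tc (e X').2 Y)
    (Jc : Matrix (SpaceTimeIdx L M × SectorLeg (sectorCount j)) (SpaceTimeIdx L M × SectorLeg N₁) ℂ) (Jf : Matrix (SpaceTimeIdx Lf M × SectorLeg (sectorCount j)) (SpaceTimeIdx Lf M × SectorLeg N₁) ℂ)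
    (hPJ : ∀ (X' : (SpaceTimeIdx Lf M × SectorLeg (sectorCount j))) (Y : (SpaceTimeIdx L M × SectorLeg N₁)),
      ∑ Y'' ∈ univ.filter (fun Y'' : (SpaceTimeIdx Lf M × SectorLeg N₁) => (e₁ Y'').2 = Y), Jf X' Y'' = Jc (e X').2 Y)
    (Tpc : Matrix ((SpaceTimeIdx L M × SectorLeg (sectorCount j)) × Fin 2) ((SpaceTimeIdx L M × SectorLeg N₁) × Fin 2) ℂ)
    (hTpc : ∀ p' p, Tpc p' p = if p'.2 = 0 ∧ p.2 = 0 then Tc p'.1 p.1 else if p'.2 = 1 ∧ p.2 = 1 then Jc p'.1 p.1 else 0)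
    (Tpf : Matrix ((SpaceTimeIdx Lf M × SectorLeg (sectorCount j)) × Fin 2) ((SpaceTimeIdx Lf M × SectorLeg N₁) × Fin 2) ℂ)
    (hTpf : ∀ p' p, Tpf p' p = if p'.2 = 0 ∧ p.2 = 0 then Tf p'.1 p.1 else if p'.2 = 1 ∧ p.2 = 1 then Jf p'.1 p.1 else 0)
    -- the region schedule: zone depth `R`, extra pin depth `R′`, transfer radii `RN ≤ RZ`, `RF`, tail radius `r` (`r ≤ RN`, `r ≤ RF`, `r + RZ ≤ R`); the pin
    (R R' RN RZ RF r : ℕ) (hNZ : RN ≤ RZ) (hrN : r ≤ RN) (hrF : r ≤ RF) (hrZR : r + RZ ≤ R)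
    (w : ((SpaceTimeIdx Lf M × SectorLeg (sectorCount j)) × Fin 2)) (hw : ∀ j, R + R' ≤ (w.1.1.2 j).val % L ∧ (w.1.1.2 j).val % L + (R + R') < L)
    -- THE NORMALISATION `ε`; ONE-VOLUME COVARIANCE DATA (rows `aW/ε`), the fine sectional row, the transfer bundle
    {ε : ℝ} (hε : 0 < ε)
    {κ κ' aW aW' sW sW' eW' : ℝ} (hC : ScaleCovData CL Λ κ (aW / ε) sW) (hC' : ScaleCovData CLf Λ κ' (aW' / ε) sW') (hCsec : ScaleCovSecData CLf Λ eW')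
    {ΛT cW : ℝ} (hTr : TransferWtData Tpf ed ed₁ ΛT cW)
    -- the two DOUBLED scale-`j` actions and their normalised profiles (`ε ×` volume-free budgets): coarse raw, coarse re-analysed (E1's read-out), fine raw
    (𝒲 : GrassmannAlgebra ℂ ((SpaceTimeIdx L M × SectorLeg N₁) × Fin 2)) (h𝒲e : 𝒲 ∈ evenOdd ℂ 0) (h𝒲0 : constPart ℂ 𝒲 = 0)
    (𝒲' : GrassmannAlgebra ℂ ((SpaceTimeIdx Lf M × SectorLeg N₁) × Fin 2)) (h𝒲'e : 𝒲' ∈ evenOdd ℂ 0) (h𝒲'0 : constPart ℂ 𝒲' = 0)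
    {Λ₁ : ℝ} (hΛ₁ : 0 ≤ Λ₁) (hΛT : Λ ≤ ΛT) (hΛΛ₁ : Λ ≤ Λ₁) (N𝒲 NV N𝒲' : ℕ → ℝ) (hNV0 : ∀ m', 0 ≤ NV m') (hN𝒲'0 : ∀ k, 0 ≤ N𝒲' k)
    (hN𝒲 : WtProfileRaw 𝒲 Λ₁ (fun k => ε * N𝒲 k)) (hNV : WtProfileEven (ExteriorAlgebra.map (Matrix.toLin' Tpc) 𝒲) Λ (fun m' => ε * NV m'))
    (hN𝒲' : WtProfileRaw 𝒲' Λ₁ (fun k => ε * N𝒲' k))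
    -- the scale-`j` TWO-VOLUME data (normalised): deep `ε·Ej`, everywhere `ε·NDj`; the normalised transfer majorant `Ein`
    (Ej NDj : ℕ → ℝ)
    (hD : KeyedDefectData (N := sectorCount j) ed₁ 𝒲' 𝒲 R RF (fun k => ε * Ej k) (fun k => ε * NDj k))
    (Ein : ℕ → ℝ) (hEin0 : ∀ m', 0 ≤ Ein m')
    (hEin : ∀ m', 1 ≤ m' → ∀ n : ℕ, 2 * m' = n + 1 →
      cW ^ n * (cW * Ej (n + 1) + cW / (1 + ΛT * ((r : ℝ) + 1)) * NDj (n + 1)) +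
        (2 * cW ^ n * (cW / (1 + ΛT * ((r : ℝ) + 1))) * N𝒲 (n + 1) +
          n * cW ^ n * (5 * (cW / (1 + ΛT * ((r : ℝ) + 1))) * N𝒲 (n + 1) + 2 * cW * ((1 + Λ₁ * (((RZ - RN : ℕ) : ℝ) + 1))⁻¹ * N𝒲 (n + 1)))) ≤ Ein m')
    -- THE FINE VOLUME'S OWN-FRAME STEP (normalised frame data: `sE`, `δ` ε-free, rows `cR/ε, cC/ε`; volume-free caps `cRb, cCb, δb`)
    (CLf'' : Matrix (SpaceTimeIdx Lf M × SectorLeg (sectorCount j)) (SpaceTimeIdx Lf M × SectorLeg (sectorCount j)) ℂ)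
    (Cd'' : Matrix ((SpaceTimeIdx Lf M × SectorLeg (sectorCount j)) × Fin 2) ((SpaceTimeIdx Lf M × SectorLeg (sectorCount j)) × Fin 2) ℂ)
    (hCd'' : ∀ p q, Cd'' p q = if p.2 = 0 ∧ q.2 = 0 then CLf'' p.1 q.1 else 0)
    (Tpf'' : Matrix ((SpaceTimeIdx Lf M × SectorLeg (sectorCount j)) × Fin 2) ((SpaceTimeIdx Lf M × SectorLeg N₁) × Fin 2) ℂ)
    {κf sE cR cC cRb cCb δ δb : ℝ} (hκf : 0 < κf) (hGBf : ∀ t ∈ Set.Icc (0 : ℝ) 1, IsGramBoundedR (CLf + t • (CLf'' - CLf)) κf)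
    (hsE0 : 0 ≤ sE) (hsE : ∀ x y, ‖(CLf'' - CLf) x y‖ ≤ sE) (hcR : 0 ≤ cR) (hcC : 0 ≤ cC) (hcRb : cR ≤ cRb) (hcCb : cC ≤ cCb)
    (hER : ∀ x, ∑ y, ‖(CLf'' - CLf) x y‖ ≤ cR / ε) (hEC : ∀ y, ∑ x, ‖(CLf'' - CLf) x y‖ ≤ cC / ε)
    (hδ : 0 ≤ δ) (hδb : δ ≤ δb) (hδrow : ∀ x, ∑ y, ‖Tpf'' x y - Tpf x y‖ ≤ δ) (hδcol : ∀ y, ∑ x, ‖Tpf'' x y - Tpf x y‖ ≤ δ)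
    -- FIELD RADII, VOLUME-FREE MAJORANTS OF THE FIELD-WEIGHTED NORMS OF THE BUDGETS, BARRED SMALLNESS
    {ρ₀ ρf ρ₂ ρ' ρ₃ ν₀ ν₁ ν₂ ν₃ ν₄ ν₅ νE ν₆ ν₇ ν₈ : ℝ} (hρ₀ : 0 < ρ₀) (hρf : 0 < ρf) (hρ₂ : 0 < ρ₂) (hρ' : 0 < ρ') (hρ₃ : 0 < ρ₃)
    (hν₀ : normV ((SpaceTimeIdx L M × SectorLeg (sectorCount j)) × Fin 2) κ ρ₀ NV ≤ ν₀) (hθ₀ : Real.exp 1 * aW * ν₀ / κ ^ 2 < 1)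
    (Nw₁ : ℕ → ℝ) (hNw₁ : ∀ m', Nw₁ m' = ρ₀⁻¹ ^ (2 * m') * (Real.exp 1 * ν₀) / (1 - Real.exp 1 * aW * ν₀ / κ ^ 2))
    (hν₅ : normV ((SpaceTimeIdx Lf M × SectorLeg (sectorCount j)) × Fin 2) (κ' + κ) ρf Nw₁ ≤ ν₅) (hθw : Real.exp 1 * (aW' + aW + (aW' + aW)) * ν₅ / (κ' + κ) ^ 2 < 1)
    (hν₄ : normV ((SpaceTimeIdx Lf M × SectorLeg (sectorCount j)) × Fin 2) (κ' + κ + (κ' + κ + (κ' + κ))) ρ₂ Nw₁ ≤ ν₄)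
    (hθ₂ : Real.exp 1 * (aW' + aW + (aW' + aW)) * ν₄ / (κ' + κ + (κ' + κ + (κ' + κ))) ^ 2 < 1)
    (NW' : ℕ → ℝ) (hNW'def : ∀ m', NW' m' = cW ^ (2 * m' - 1) * (cW * N𝒲' (2 * m')))
    (hν₁ : normV ((SpaceTimeIdx Lf M × SectorLeg (sectorCount j)) × Fin 2) κ' ρ' (fun m' => NV m' + (NW' m' + NV m')) ≤ ν₁) (hν₂ : normV ((SpaceTimeIdx Lf M × SectorLeg (sectorCount j)) × Fin 2) κ' ρ' (fun m' => NW' m' + NV m') ≤ ν₂)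
    (hν₃ : normV ((SpaceTimeIdx Lf M × SectorLeg (sectorCount j)) × Fin 2) κ' ρ' NV ≤ ν₃) (hνE : normV ((SpaceTimeIdx Lf M × SectorLeg (sectorCount j)) × Fin 2) κ' ρ' Ein ≤ νE)
    (hbar : Real.exp 1 * aW' * (ν₁ + νE) / κ' ^ 2 < 1) (hθ₂' : Real.exp 1 * aW' * (ν₃ + ν₂) / κ' ^ 2 < 1)
    (hν₆ : normV ((SpaceTimeIdx Lf M × SectorLeg (sectorCount j)) × Fin 2) κf ρ₃ (fun m' => NW' m' + (2 * m' : ℕ) * (cW + δb) ^ (2 * m' - 1) * δb * N𝒲' (2 * m')) ≤ ν₆) (hν₇ : normV ((SpaceTimeIdx Lf M × SectorLeg (sectorCount j)) × Fin 2) κf ρ₃ NW' ≤ ν₇)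
    (hν₈ : normV ((SpaceTimeIdx Lf M × SectorLeg (sectorCount j)) × Fin 2) κf ρ₃ (fun m' => (2 * m' : ℕ) * (cW + δb) ^ (2 * m' - 1) * N𝒲' (2 * m')) ≤ ν₈)
    (hθf₁ : Real.exp 1 * (aW' + (cRb + cCb)) * ν₆ / κf ^ 2 < 1) (hθf₂ : Real.exp 1 * aW' * (ν₇ + δb * ν₈) / κf ^ 2 < 1)
    (n : ℕ) (p : Fin (n + 1)) :
    ∑ X ∈ univ.filter (fun X : Fin (n + 1) → ((SpaceTimeIdx Lf M × SectorLeg (sectorCount j)) × Fin 2) => X p = w),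
        ‖kernel ℂ (effAction ℂ Cd'' (ExteriorAlgebra.map (Matrix.toLin' Tpf'') 𝒲')) (n + 1) X -
          (if ∀ i, (ed (X i)).1 = (ed (X p)).1 then
            kernel ℂ (effAction ℂ Cd (ExteriorAlgebra.map (Matrix.toLin' Tpc) 𝒲)) (n + 1) (fun i => (ed (X i)).2) else 0)‖ ≤
      ε * (((ρ'⁻¹ ^ (n + 1) * Real.exp 1 / (1 - Real.exp 1 * aW' * (ν₁ + νE) / κ' ^ 2) ^ 2)) * normV ((SpaceTimeIdx Lf M × SectorLeg (sectorCount j)) × Fin 2) κ' ρ' Ein +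
        ((ρ'⁻¹ ^ (n + 1) * (Real.exp 1 * ν₂) / (1 - Real.exp 1 * aW' * (ν₃ + ν₂) / κ' ^ 2) ^ 2)) * (1 + Λ * ((R' : ℝ) + 1))⁻¹ +
        ((((((n + 1 + 1) * (n + 1 + 2) : ℕ) : ℝ) / 2 *
            (ρ₂⁻¹ ^ (n + 3) * (Real.exp 1 * ν₄) / (1 - Real.exp 1 * (aW' + aW + (aW' + aW)) * ν₄ / (κ' + κ + (κ' + κ + (κ' + κ))) ^ 2)))) +
          (((((n + 1 + 1) * (n + 1 + 2) : ℕ) : ℝ) / 2 * (ρ₃⁻¹ ^ (n + 3) * (Real.exp 1 * ν₆) / (1 - Real.exp 1 * (aW' + (cRb + cCb)) * ν₆ / κf ^ 2))) +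
           (‖(2 : ℂ)⁻¹‖ * ∑ a' ∈ range (n + 2), ∑ b' ∈ range (n + 2),
          (if a' + b' = n + 1 then (((a' + 1) * (b' + 1) : ℕ) : ℝ) *
            ((ρ₃⁻¹ ^ (a' + 1) * (Real.exp 1 * ν₆) / (1 - Real.exp 1 * (aW' + (cRb + cCb)) * ν₆ / κf ^ 2)) *
              (ρ₃⁻¹ ^ (b' + 1) * (Real.exp 1 * ν₆) / (1 - Real.exp 1 * (aW' + (cRb + cCb)) * ν₆ / κf ^ 2))) else 0)) +
           (ρ₃⁻¹ ^ (n + 1) * (Real.exp 1 * ν₈) / (1 - Real.exp 1 * aW' * (ν₇ + δb * ν₈) / κf ^ 2) ^ 2))) * (eW' / (1 + Λ * ((R : ℝ) + 1)) + (sE + (cR + cC) + δ)) +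
        ((‖(2 : ℂ)⁻¹‖ * ∑ a ∈ range (n + 2), ∑ b ∈ range (n + 2),
            (if a + b = n + 1 then (((a + 1) * (b + 1) : ℕ) : ℝ) *
              (4 * (ρ₂⁻¹ ^ (a + 1) * (Real.exp 1 * ν₄) / (1 - Real.exp 1 * (aW' + aW + (aW' + aW)) * ν₄ / (κ' + κ + (κ' + κ + (κ' + κ))) ^ 2)) *
                (ρ₂⁻¹ ^ (b + 1) * (Real.exp 1 * ν₄) / (1 - Real.exp 1 * (aW' + aW + (aW' + aW)) * ν₄ / (κ' + κ + (κ' + κ + (κ' + κ))) ^ 2))) else 0))) * (aW' / (1 + Λ * ((R : ℝ) + 1))) +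
        (((((n + 1 + 1) * (n + 1 + 2) : ℕ) : ℝ) / 2 * (sW' + sW) *
              (ρf⁻¹ ^ (n + 3) * (Real.exp 1 * ν₅) / (1 - Real.exp 1 * (aW' + aW + (aW' + aW)) * ν₅ / (κ' + κ) ^ 2)) +
            ‖(2 : ℂ)⁻¹‖ * ∑ a ∈ range (n + 2), ∑ b ∈ range (n + 2),
              (if a + b = n + 1 then (((a + 1) * (b + 1) : ℕ) : ℝ) *
                (2 * (aW' + aW) * (ρf⁻¹ ^ (a + 1) * (Real.exp 1 * ν₅) / (1 - Real.exp 1 * (aW' + aW + (aW' + aW)) * ν₅ / (κ' + κ) ^ 2)) *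
                  (ρf⁻¹ ^ (b + 1) * (Real.exp 1 * ν₅) / (1 - Real.exp 1 * (aW' + aW + (aW' + aW)) * ν₅ / (κ' + κ) ^ 2))) else 0))) * (Λ * ((R' : ℝ) + 1))⁻¹) := by
  classical
  -- §0 signs and the norm algebra
  have hε0 : ε ≠ 0 := hε.ne'
  have he0 : 0 ≤ Real.exp 1 := (Real.exp_pos 1).le
  have haW : 0 < aW := by have h := mul_pos hC.αW_pos hε; rwa [div_mul_cancel₀ _ hε0] at h
  have haW' : 0 < aW' := by have h := mul_pos hC'.αW_pos hε; rwa [div_mul_cancel₀ _ hε0] at h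
  have hκ := hC.κ_pos
  have hκ' := hC'.κ_pos
  have hcW := hTr.cW_nonneg
  have hdm : ∀ A Y : ℝ, A / ε * (ε * Y) = A * Y := fun A Y => by field_simp
  have hNW'0 : ∀ m', 0 ≤ NW' m' := fun m' => by rw [hNW'def]; exact mul_nonneg (pow_nonneg hcW _) (mul_nonneg hcW (hN𝒲'0 _))
  have hδb0 : 0 ≤ δb := hδ.trans hδb
  have hcδ : 0 ≤ cW + δ := add_nonneg hcW hδ
  -- the coarse output profile of the step (ε-free, volume-dependent) and its volume-free majorant
  set X₀ : ℝ := normV ((SpaceTimeIdx L M × SectorLeg (sectorCount j)) × Fin 2) κ ρ₀ NV with hX₀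
  have hX₀0 : 0 ≤ X₀ := normV_nonneg hκ.le hρ₀.le hNV0
  have hθ₀le : Real.exp 1 * aW * X₀ / κ ^ 2 ≤ Real.exp 1 * aW * ν₀ / κ ^ 2 := by gcongr
  have hθ₀X : Real.exp 1 * aW * X₀ / κ ^ 2 < 1 := hθ₀le.trans_lt hθ₀
  set Nw₀ : ℕ → ℝ := fun m' => ρ₀⁻¹ ^ (2 * m') * (Real.exp 1 * X₀) / (1 - Real.exp 1 * aW * X₀ / κ ^ 2) with hNw₀
  have hNw₀0 : ∀ m', 0 ≤ Nw₀ m' := fun m' => div_nonneg (by positivity) (by linarith)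
  have hNw₀le : ∀ m', Nw₀ m' ≤ Nw₁ m' := fun m' => by
    rw [hNw₁]; exact div_one_sub_mono (by positivity) (by gcongr) hθ₀le hθ₀
  -- the actual (ε-scaled) data in the shapes of `…ModelScaleSucc`
  have hnNV : normV ((SpaceTimeIdx L M × SectorLeg (sectorCount j)) × Fin 2) κ ρ₀ (fun m' => ε * NV m') = ε * X₀ := normV_const_mul κ ρ₀ ε NV
  have hθ₀a : Real.exp 1 * (aW / ε) * normV ((SpaceTimeIdx L M × SectorLeg (sectorCount j)) × Fin 2) κ ρ₀ (fun m' => ε * NV m') / κ ^ 2 < 1 := by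
    rw [hnNV, mul_assoc, hdm, ← mul_assoc]; exact hθ₀X
  have hNwdef : ∀ m', (fun m' => ε * Nw₀ m') m' = ρ₀⁻¹ ^ (2 * m') * (Real.exp 1 * normV ((SpaceTimeIdx L M × SectorLeg (sectorCount j)) × Fin 2) κ ρ₀ (fun m' => ε * NV m')) /
      (1 - Real.exp 1 * (aW / ε) * normV ((SpaceTimeIdx L M × SectorLeg (sectorCount j)) × Fin 2) κ ρ₀ (fun m' => ε * NV m') / κ ^ 2) := by
    intro m'; simp only [hNw₀]; rw [hnNV, mul_assoc (Real.exp 1) (aW / ε), hdm, ← mul_assoc]; ring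
  have hnNw : ∀ (K ρ : ℝ), normV ((SpaceTimeIdx Lf M × SectorLeg (sectorCount j)) × Fin 2) K ρ (fun m' => ε * Nw₀ m') = ε * normV ((SpaceTimeIdx Lf M × SectorLeg (sectorCount j)) × Fin 2) K ρ Nw₀ := fun K ρ => normV_const_mul K ρ ε Nw₀
  have hα : aW' / ε + aW / ε + (aW' / ε + aW / ε) = (aW' + aW + (aW' + aW)) / ε := by field_simp
  have hK0 : 0 ≤ κ' + κ := by positivity
  have hν₅' : normV ((SpaceTimeIdx Lf M × SectorLeg (sectorCount j)) × Fin 2) (κ' + κ) ρf Nw₀ ≤ ν₅ := (normV_mono hK0 hρf.le hNw₀le).trans hν₅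
  have hν₄' : normV ((SpaceTimeIdx Lf M × SectorLeg (sectorCount j)) × Fin 2) (κ' + κ + (κ' + κ + (κ' + κ))) ρ₂ Nw₀ ≤ ν₄ := (normV_mono (by positivity) hρ₂.le hNw₀le).trans hν₄
  have hθwa : Real.exp 1 * (aW' / ε + aW / ε + (aW' / ε + aW / ε)) * normV ((SpaceTimeIdx Lf M × SectorLeg (sectorCount j)) × Fin 2) (κ' + κ) ρf (fun m' => ε * Nw₀ m') / (κ' + κ) ^ 2 < 1 := by
    rw [hα, hnNw, mul_assoc, hdm, ← mul_assoc]
    exact lt_of_le_of_lt (by gcongr) hθw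
  have hθ₂a : Real.exp 1 * (aW' / ε + aW / ε + (aW' / ε + aW / ε)) * normV ((SpaceTimeIdx Lf M × SectorLeg (sectorCount j)) × Fin 2) (κ' + κ + (κ' + κ + (κ' + κ))) ρ₂ (fun m' => ε * Nw₀ m') /
      (κ' + κ + (κ' + κ + (κ' + κ))) ^ 2 < 1 := by
    rw [hα, hnNw, mul_assoc, hdm, ← mul_assoc]
    exact lt_of_le_of_lt (by gcongr) hθ₂
  -- the re-analysed profiles
  have hNW'a : ∀ m', (fun m' => ε * NW' m') m' = cW ^ (2 * m' - 1) * (cW * (fun k => ε * N𝒲' k) (2 * m')) := fun m' => by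
    simp only [hNW'def]; ring
  have hn1 : normV ((SpaceTimeIdx Lf M × SectorLeg (sectorCount j)) × Fin 2) κ' ρ' (fun m' => (fun m' => ε * NV m') m' + ((fun m' => ε * NW' m') m' + (fun m' => ε * NV m') m')) =
      ε * normV ((SpaceTimeIdx Lf M × SectorLeg (sectorCount j)) × Fin 2) κ' ρ' (fun m' => NV m' + (NW' m' + NV m')) := by
    rw [← normV_const_mul]; congr 1; funext m; ring
  have hn2 : normV ((SpaceTimeIdx Lf M × SectorLeg (sectorCount j)) × Fin 2) κ' ρ' (fun m' => (fun m' => ε * NW' m') m' + (fun m' => ε * NV m') m') = ε * normV ((SpaceTimeIdx Lf M × SectorLeg (sectorCount j)) × Fin 2) κ' ρ' (fun m' => NW' m' + NV m') := by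
    rw [← normV_const_mul]; congr 1; funext m; ring
  have hn3 : normV ((SpaceTimeIdx Lf M × SectorLeg (sectorCount j)) × Fin 2) κ' ρ' (fun m' => ε * NV m') = ε * normV ((SpaceTimeIdx Lf M × SectorLeg (sectorCount j)) × Fin 2) κ' ρ' NV := normV_const_mul κ' ρ' ε NV
  -- the transfer majorant, scaled
  have hEina : ∀ m', 1 ≤ m' → ∀ n : ℕ, 2 * m' = n + 1 →
      cW ^ n * (cW * (fun k => ε * Ej k) (n + 1) + cW / (1 + ΛT * ((r : ℝ) + 1)) * (fun k => ε * NDj k) (n + 1)) +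
        (2 * cW ^ n * (cW / (1 + ΛT * ((r : ℝ) + 1))) * (fun k => ε * N𝒲 k) (n + 1) +
          n * cW ^ n * (5 * (cW / (1 + ΛT * ((r : ℝ) + 1))) * (fun k => ε * N𝒲 k) (n + 1) +
            2 * cW * ((1 + Λ₁ * (((RZ - RN : ℕ) : ℝ) + 1))⁻¹ * (fun k => ε * N𝒲 k) (n + 1)))) ≤ (fun m' => ε * Ein m') m' := by
    intro m' hm' n hn
    have h := mul_le_mul_of_nonneg_left (hEin m' hm' n hn) hε.le
    refine le_trans (le_of_eq ?_) h
    simp only []; ring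
  have hnE : normV ((SpaceTimeIdx Lf M × SectorLeg (sectorCount j)) × Fin 2) κ' ρ' (fun m' => ε * Ein m') = ε * normV ((SpaceTimeIdx Lf M × SectorLeg (sectorCount j)) × Fin 2) κ' ρ' Ein := normV_const_mul κ' ρ' ε Ein
  have hνEa : normV ((SpaceTimeIdx Lf M × SectorLeg (sectorCount j)) × Fin 2) κ' ρ' (fun m' => ε * Ein m') ≤ ε * νE := by rw [hnE]; exact mul_le_mul_of_nonneg_left hνE hε.le
  have hbara : Real.exp 1 * (aW' / ε) *
      (normV ((SpaceTimeIdx Lf M × SectorLeg (sectorCount j)) × Fin 2) κ' ρ' (fun m' => (fun m' => ε * NV m') m' + ((fun m' => ε * NW' m') m' + (fun m' => ε * NV m') m')) + ε * νE) / κ' ^ 2 < 1 := by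
    rw [hn1, ← mul_add, mul_assoc, hdm, ← mul_assoc]
    exact lt_of_le_of_lt (by gcongr) hbar
  have hθ₂'a : Real.exp 1 * (aW' / ε) * (normV ((SpaceTimeIdx Lf M × SectorLeg (sectorCount j)) × Fin 2) κ' ρ' (fun m' => ε * NV m') +
      normV ((SpaceTimeIdx Lf M × SectorLeg (sectorCount j)) × Fin 2) κ' ρ' (fun m' => (fun m' => ε * NW' m') m' + (fun m' => ε * NV m') m')) / κ' ^ 2 < 1 := by
    rw [hn3, hn2, ← mul_add, mul_assoc, hdm, ← mul_assoc]
    exact lt_of_le_of_lt (by gcongr) hθ₂'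
  -- the frame data, scaled
  set NB₁ : ℕ → ℝ := fun m' => (2 * m' : ℕ) * (cW + δ) ^ (2 * m' - 1) * δ * N𝒲' (2 * m') with hNB₁
  have hNB₁def : ∀ m', NB₁ m' = (2 * m' : ℕ) * (cW + δ) ^ (2 * m' - 1) * δ * N𝒲' (2 * m') := fun m' => rfl
  have hNBa : ∀ m', (fun m' => ε * NB₁ m') m' = (2 * m' : ℕ) * (cW + δ) ^ (2 * m' - 1) * δ * (fun k => ε * N𝒲' k) (2 * m') := fun m' => by
    simp only [hNB₁]; ring
  have hNB₁0 : ∀ m', 0 ≤ NB₁ m' := fun m' => by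
    simp only [hNB₁]; exact mul_nonneg (mul_nonneg (mul_nonneg (by positivity) (pow_nonneg hcδ _)) hδ) (hN𝒲'0 _)
  have hab : cW + δ ≤ cW + δb := by linarith
  have hA : ∀ m', ((2 * m' : ℕ) : ℝ) * (cW + δ) ^ (2 * m' - 1) ≤ ((2 * m' : ℕ) : ℝ) * (cW + δb) ^ (2 * m' - 1) := fun m' =>
    mul_le_mul_of_nonneg_left (pow_le_pow_left₀ hcδ hab _) (by positivity)
  have hA0 : ∀ m', (0 : ℝ) ≤ ((2 * m' : ℕ) : ℝ) * (cW + δb) ^ (2 * m' - 1) := fun m' => by positivity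
  have hNB₁le : ∀ m', NB₁ m' ≤ (2 * m' : ℕ) * (cW + δb) ^ (2 * m' - 1) * δb * N𝒲' (2 * m') := fun m' => by
    simp only [hNB₁]
    exact mul_le_mul_of_nonneg_right (mul_le_mul (hA m') hδb hδ (hA0 m')) (hN𝒲'0 _)
  have hν₆' : normV ((SpaceTimeIdx Lf M × SectorLeg (sectorCount j)) × Fin 2) κf ρ₃ (fun m' => NW' m' + (2 * m' : ℕ) * (cW + δ) ^ (2 * m' - 1) * δb * N𝒲' (2 * m')) ≤ ν₆ := by
    refine le_trans (normV_mono hκf.le hρ₃.le fun m' => ?_) hν₆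
    exact add_le_add le_rfl (mul_le_mul_of_nonneg_right (mul_le_mul_of_nonneg_right (hA m') hδb0) (hN𝒲'0 _))
  have hν₈' : normV ((SpaceTimeIdx Lf M × SectorLeg (sectorCount j)) × Fin 2) κf ρ₃ (fun m' => (2 * m' : ℕ) * (cW + δ) ^ (2 * m' - 1) * N𝒲' (2 * m')) ≤ ν₈ :=
    le_trans (normV_mono hκf.le hρ₃.le fun m' => mul_le_mul_of_nonneg_right (hA m') (hN𝒲'0 _)) hν₈
  have hX₆le : normV ((SpaceTimeIdx Lf M × SectorLeg (sectorCount j)) × Fin 2) κf ρ₃ (fun m' => NW' m' + NB₁ m') ≤ ν₆ :=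
    le_trans (normV_mono hκf.le hρ₃.le fun m' => by linarith [hNB₁le m']) hν₆
  have hXB : normV ((SpaceTimeIdx Lf M × SectorLeg (sectorCount j)) × Fin 2) κf ρ₃ NB₁ ≤ δb * ν₈ := by
    have h1 : normV ((SpaceTimeIdx Lf M × SectorLeg (sectorCount j)) × Fin 2) κf ρ₃ NB₁ = δ * normV ((SpaceTimeIdx Lf M × SectorLeg (sectorCount j)) × Fin 2) κf ρ₃ (fun m' => (2 * m' : ℕ) * (cW + δ) ^ (2 * m' - 1) * N𝒲' (2 * m')) := by
      rw [← normV_const_mul]; congr 1; funext m'; simp only [hNB₁]; ring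
    rw [h1]
    have hν₈0 : 0 ≤ ν₈ := (normV_nonneg hκf.le hρ₃.le fun m' => mul_nonneg (mul_nonneg (by positivity) (pow_nonneg hcδ _)) (hN𝒲'0 _)).trans hν₈'
    exact (mul_le_mul_of_nonneg_left hν₈' hδ).trans (mul_le_mul_of_nonneg_right hδb hν₈0)
  have hnF1 : normV ((SpaceTimeIdx Lf M × SectorLeg (sectorCount j)) × Fin 2) κf ρ₃ (fun m' => (fun m' => ε * NW' m') m' + (fun m' => ε * NB₁ m') m') = ε * normV ((SpaceTimeIdx Lf M × SectorLeg (sectorCount j)) × Fin 2) κf ρ₃ (fun m' => NW' m' + NB₁ m') := by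
    rw [← normV_const_mul]; congr 1; funext m; ring
  have hnF2 : normV ((SpaceTimeIdx Lf M × SectorLeg (sectorCount j)) × Fin 2) κf ρ₃ (fun m' => ε * NW' m') = ε * normV ((SpaceTimeIdx Lf M × SectorLeg (sectorCount j)) × Fin 2) κf ρ₃ NW' := normV_const_mul κf ρ₃ ε NW'
  have hnF3 : normV ((SpaceTimeIdx Lf M × SectorLeg (sectorCount j)) × Fin 2) κf ρ₃ (fun m' => ε * NB₁ m') = ε * normV ((SpaceTimeIdx Lf M × SectorLeg (sectorCount j)) × Fin 2) κf ρ₃ NB₁ := normV_const_mul κf ρ₃ ε NB₁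
  have hcRb0 : 0 ≤ cRb := hcR.trans hcRb
  have hcCb0 : 0 ≤ cCb := hcC.trans hcCb
  have hθf₁a : Real.exp 1 * (aW' / ε + (cR / ε + cC / ε)) * normV ((SpaceTimeIdx Lf M × SectorLeg (sectorCount j)) × Fin 2) κf ρ₃ (fun m' => (fun m' => ε * NW' m') m' + (fun m' => ε * NB₁ m') m') / κf ^ 2 < 1 := by
    have hα' : aW' / ε + (cR / ε + cC / ε) = (aW' + (cR + cC)) / ε := by field_simp
    rw [hα', hnF1, mul_assoc, hdm, ← mul_assoc]
    have hX₆0 : 0 ≤ normV ((SpaceTimeIdx Lf M × SectorLeg (sectorCount j)) × Fin 2) κf ρ₃ (fun m' => NW' m' + NB₁ m') := normV_nonneg hκf.le hρ₃.le fun m' => add_nonneg (hNW'0 m') (hNB₁0 m')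
    have h1 : Real.exp 1 * (aW' + (cR + cC)) * normV ((SpaceTimeIdx Lf M × SectorLeg (sectorCount j)) × Fin 2) κf ρ₃ (fun m' => NW' m' + NB₁ m') ≤ Real.exp 1 * (aW' + (cRb + cCb)) * ν₆ :=
      mul_le_mul (by gcongr) hX₆le hX₆0 (by positivity)
    exact lt_of_le_of_lt (div_le_div_of_nonneg_right h1 (sq_nonneg _)) hθf₁
  have hθf₂a : Real.exp 1 * (aW' / ε) * (normV ((SpaceTimeIdx Lf M × SectorLeg (sectorCount j)) × Fin 2) κf ρ₃ (fun m' => ε * NW' m') + normV ((SpaceTimeIdx Lf M × SectorLeg (sectorCount j)) × Fin 2) κf ρ₃ (fun m' => ε * NB₁ m')) / κf ^ 2 < 1 := by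
    rw [hnF2, hnF3, ← mul_add, mul_assoc, hdm, ← mul_assoc]
    exact lt_of_le_of_lt (by gcongr) hθf₂
  -- §1 the composite step at the scaled data
  have hcomp := model_sum_norm_kernel_twoVolume_scaleSucc_composite_le μ K j hLf hβ hΛ e he1 he2 ed hed e₁ he₁1 he₁2 ed₁ hed₁ CL hCL CLf hCLf Cd hCd Cd' hCd'
    Tc Tf hPT₀ Jc Jf hPJ Tpc hTpc Tpf hTpf R R' RN RZ RF r hNZ hrN hrF hrZR w hw hC hC' hCsec hTr 𝒲 h𝒲e h𝒲0 𝒲' h𝒲'e h𝒲'0 hΛ₁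
    (fun k => ε * N𝒲 k) (fun m' => ε * NV m') (fun m' => ε * NW' m') hN𝒲 hNV (fun k => ε * N𝒲' k) hN𝒲' hΛT hΛΛ₁ hNW'a hρ₀ hθ₀a (fun m' => ε * Nw₀ m') hNwdef
    hρf hθwa hρ₂ hθ₂a (fun k => ε * Ej k) (fun k => ε * NDj k) hD (fun m' => ε * Ein m') (fun m' => mul_nonneg hε.le (hEin0 m')) hEina hρ' hνEa hbara hθ₂'a
    CLf'' Cd'' hCd'' Tpf'' hκf hGBf hsE0 hsE (by positivity) (by positivity) hER hEC hδ hδrow hδcol (fun m' => ε * NB₁ m') hNBa hρ₃ hθf₁a hθf₂a n p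
  beta_reduce at hcomp
  -- §2 the two right-hand sides are `ε ×` their normalised forms
  have hH1 := frameComposite_rhs_eps_homog ((SpaceTimeIdx Lf M × SectorLeg (sectorCount j)) × Fin 2) n hε0 sE cR cC aW' κf ρ₃ (cW + δ) δ NW' N𝒲' NB₁ (fun m' => ε * NB₁ m') hNB₁def
    (fun m' => by simp only [hNB₁]; ring)
  have hH2 := minS_rhs_eps_homog ((SpaceTimeIdx Lf M × SectorLeg (sectorCount j)) × Fin 2) n hε0 aW aW' sW sW' eW' κ κ' ρ' ρ₂ ρf Λ νE R R' NV NW' Nw₀ Ein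
  beta_reduce at hH1 hH2
  rw [hH1, hH2] at hcomp
  -- §3 the normalised forms are at most the volume-free linear forms
  have hF := frameComposite_rhs_le_linear ((SpaceTimeIdx Lf M × SectorLeg (sectorCount j)) × Fin 2) n NB₁ hNB₁def hκf.le hρ₃ hsE0 hcR hcC hcRb hcCb haW'.le (by positivity : 0 ≤ cW + δ) hδ hδb hNW'0 hN𝒲'0
    hν₆' hν₇ hν₈' hθf₁ hθf₂
  have heW' : 0 ≤ eW' := by
    obtain ⟨⟨t, y⟩, ℓ⟩ := w.1
    exact le_trans (sum_nonneg fun _ _ => by positivity) (hCsec.sec w.1 t ℓ)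
  have hM := minS_rhs_le_linear ((SpaceTimeIdx Lf M × SectorLeg (sectorCount j)) × Fin 2) n (eW' := eW') R R' hκ.le hκ'.le hρ' hρ₂ hρf haW.le haW'.le
    hC.sW_nonneg hC'.sW_nonneg heW' hΛ.le hNV0 hNW'0 hNw₀0 hEin0 hν₁ hν₂ hν₃ hν₄' hν₅' hbar hθ₂' hθ₂ hθw
  refine hcomp.trans ?_
  rw [← mul_add]
  refine mul_le_mul_of_nonneg_left ?_ hε.le
  -- §4 fold the frame terms into the `Te` slot (name the blocks first)
  have hν₆0 : 0 ≤ ν₆ := (normV_nonneg hκf.le hρ₃.le fun m' => add_nonneg (hNW'0 m') (hNB₁0 m')).trans hX₆le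
  have hν₈0 : 0 ≤ ν₈ := (normV_nonneg hκf.le hρ₃.le fun m' => mul_nonneg (mul_nonneg (by positivity) (pow_nonneg hcδ _)) (hN𝒲'0 _)).trans hν₈'
  have hν₄0 : 0 ≤ ν₄ := (normV_nonneg (by positivity) hρ₂.le hNw₀0).trans hν₄'
  have hG₆ : ∀ k : ℕ, 0 ≤ ρ₃⁻¹ ^ k * (Real.exp 1 * ν₆) / (1 - Real.exp 1 * (aW' + (cRb + cCb)) * ν₆ / κf ^ 2) := fun k =>
    div_nonneg (by positivity) (by linarith)
  have hG₄ : ∀ k : ℕ, 0 ≤ ρ₂⁻¹ ^ k * (Real.exp 1 * ν₄) / (1 - Real.exp 1 * (aW' + aW + (aW' + aW)) * ν₄ / (κ' + κ + (κ' + κ + (κ' + κ))) ^ 2) := fun k =>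
    div_nonneg (by positivity) (by linarith)
  set K₁ : ℝ := (((n + 1 + 1) * (n + 1 + 2) : ℕ) : ℝ) / 2 * (ρ₃⁻¹ ^ (n + 3) * (Real.exp 1 * ν₆) / (1 - Real.exp 1 * (aW' + (cRb + cCb)) * ν₆ / κf ^ 2)) with hK₁
  set K₂ : ℝ := ‖(2 : ℂ)⁻¹‖ * ∑ a' ∈ range (n + 2), ∑ b' ∈ range (n + 2),
          (if a' + b' = n + 1 then (((a' + 1) * (b' + 1) : ℕ) : ℝ) *
            ((ρ₃⁻¹ ^ (a' + 1) * (Real.exp 1 * ν₆) / (1 - Real.exp 1 * (aW' + (cRb + cCb)) * ν₆ / κf ^ 2)) *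
              (ρ₃⁻¹ ^ (b' + 1) * (Real.exp 1 * ν₆) / (1 - Real.exp 1 * (aW' + (cRb + cCb)) * ν₆ / κf ^ 2))) else 0) with hK₂
  set K₃ : ℝ := ρ₃⁻¹ ^ (n + 1) * (Real.exp 1 * ν₈) / (1 - Real.exp 1 * aW' * (ν₇ + δb * ν₈) / κf ^ 2) ^ 2 with hK₃
  set KTe : ℝ := ((((n + 1 + 1) * (n + 1 + 2) : ℕ) : ℝ) / 2 *
            (ρ₂⁻¹ ^ (n + 3) * (Real.exp 1 * ν₄) / (1 - Real.exp 1 * (aW' + aW + (aW' + aW)) * ν₄ / (κ' + κ + (κ' + κ + (κ' + κ))) ^ 2))) with hKTe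
  have hK1 : 0 ≤ K₁ := mul_nonneg (by positivity) (hG₆ _)
  have hK2 : 0 ≤ K₂ := by
    refine mul_nonneg (norm_nonneg _) (sum_nonneg fun a' _ => sum_nonneg fun b' _ => ?_)
    split_ifs
    · exact mul_nonneg (by positivity) (mul_nonneg (hG₆ _) (hG₆ _))
    · exact le_rfl
  have hK3 : 0 ≤ K₃ := div_nonneg (by positivity) (sq_nonneg _)
  have hKTe : 0 ≤ KTe := mul_nonneg (by positivity) (hG₄ _)
  have hS3 : 0 ≤ eW' / (1 + Λ * ((R : ℝ) + 1)) := by have hΛ0 := hΛ.le; positivity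
  have hcc : 0 ≤ cR + cC := add_nonneg hcR hcC
  clear_value K₁ K₂ K₃ KTe
  have hfold : sE * K₁ + (cR + cC) * K₂ + δ * K₃ + KTe * (eW' / (1 + Λ * ((R : ℝ) + 1))) ≤
      (KTe + (K₁ + K₂ + K₃)) * (eW' / (1 + Λ * ((R : ℝ) + 1)) + (sE + (cR + cC) + δ)) := by
    clear hcomp hF hM hH1 hH2
    have hid : (KTe + (K₁ + K₂ + K₃)) * (eW' / (1 + Λ * ((R : ℝ) + 1)) + (sE + (cR + cC) + δ)) =
        (sE * K₁ + (cR + cC) * K₂ + δ * K₃ + KTe * (eW' / (1 + Λ * ((R : ℝ) + 1)))) +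
          (KTe * (sE + (cR + cC) + δ) + (K₁ + K₂ + K₃) * (eW' / (1 + Λ * ((R : ℝ) + 1))) + K₁ * ((cR + cC) + δ) + K₂ * (sE + δ) +
            K₃ * (sE + (cR + cC))) := by ring
    rw [hid]
    have hΛ0 := hΛ.le
    exact le_add_of_nonneg_right (by positivity)
  clear hcomp hH1 hH2
  linarith only [hF, hM, hfold]

end Summit.HubbardSuperconductivity.HubbardSuperconductivity.Theorems.TwoVolumeDefect

end
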